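import Summits.QuantumFields.YangMills.Theorems.BalabanUVNodesK2CornerDriftOfU3

/-!
# PORT-1 g2: BY-NAME APPLICABILITY CHECK of the LANDED `Theorems/BalabanUVNodesK2CornerDriftOfU3.lean` (p613914; fourth corner-road file) against plan g84's REGISTERED v7c texts
# (`D84-K2V7/K2Skeleton13SepCoPHv7c.lean` 795c9e8285fed415: `Window13` :307, 2ᶜᴰ `CornerDriftPos` :540, stub name `stub_cornerDriftPos13` :911), idea-7's `U3TripleAtRecord13K` and
# p609637's κ-free sign texts.  SCRATCH ∕ EVIDENCE ONLY: `stub_…` are `sorry`ed HERE; nothing registered or claimed by this file; K2⁷ OPEN; nothing of Bałaban asserted; YM mass gap NOT proved.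
-/

noncomputable section

/-! ## SCRATCH (not filed): BY-NAME APPLICABILITY of `Theorems/BalabanUVNodesK2CornerDriftOfU3.lean` against plan g84's v7c texts (`D84-K2V7/K2Skeleton13SepCoPHv7c.lean`
sha16 e44bc6edd44424e5: `Window13` :307, 2ᶜᴰ `CornerDriftPos` :540 VERBATIM; registered-to-be stub name `stub_cornerDriftPos13` :907), idea-7's `U3TripleAtRecord13K` (sketch :1509)
and p609637's κ-free texts.  `stub_…` are `sorry`ed HERE ONLY; nothing registered or claimed; K2⁷ OPEN;
YM mass gap (Clay) NOT proved. -/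
namespace Summit.QuantumFields.YangMills.Cruxes.EndpointGivenBR13SepCoPH.Port2CornerDriftOfU3Apply

open Filter Topology
open Literature.MathematicalPhysics.QuantumFieldTheory.Balaban1983to89
open Literature.MathematicalPhysics.QuantumFieldTheory.Balaban1983to89.T4Continuum (T4Family)
open Literature.MathematicalPhysics.QuantumFieldTheory.Balaban1983to89.T4CouplingMatching (ScaleShiftRate HistLipschitz)
open Literature.MathematicalPhysics.QuantumFieldTheory.Balaban1983to89.Beta.Drift (OneLoopDrift)
open Literature.MathematicalPhysics.QuantumFieldTheory.Balaban1983to89.Beta.RateCertificate (CauchyRate)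
open Summit.QuantumFields.YangMills.Theorems.BalabanUVNodesK2JsOfRecord (StepColourData beta0OfJs)
open Summit.QuantumFields.YangMills.Theorems.BalabanUVNodesK2NamedJetsRemAt (ScaleAnchor)
open Summit.QuantumFields.YangMills.Theorems.BalabanUVNodesK2CornerDriftOfU3

/-- v7c :307 = v6 :241 verbatim -/
def Window13 (F : T4Family) (θ : Node00.Stage13HParams F 2) (hP : θ.Provisos₁₃SepCoPH F 2) : Prop :=
  ∃ γ₁ : ℝ, 0 < γ₁ ∧ ∀ γ : ℝ, 0 < γ → γ ≤ γ₁ → ∃ P : B12.RunParams, 1 ≤ P.K ∧ ((Node00.datumOfRecord₁₃SepCoPH F 2 θ hP).C P).flow.InInterval γ P.K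

/-- v7c :540 verbatim (2ᶜᴰ) -/
def CornerDriftPos : Prop :=
  ∀ (F : T4Family) (θ : Node00.Stage13HParams F 2) (hP : θ.Provisos₁₃SepCoPH F 2), (θ.ZhUnity F 2 ∧ θ.SlotsNondegenerate₁₃ F 2) → θ.Admissible F 2 →
    B16.EndStatementBPrinted (Node00.datumOfRecord₁₃SepCoPH F 2 θ hP).C → Window13 F θ hP →
    ∃ (b : ℕ → ℝ) (s A : ℝ), ScaleAnchor (Node00.datumOfRecord₁₃SepCoPH F 2 θ hP).βfun b ∧ 0 < s ∧ OneLoopDrift s A b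

/-- sketch :1509 verbatim -/
def U3TripleAtRecord13K : Prop :=
  ∀ (F : T4Family) (θ : Node00.Stage13HParams F 2) (hP : θ.Provisos₁₃SepCoPH F 2), (θ.ZhUnity F 2 ∧ θ.SlotsNondegenerate₁₃ F 2) → θ.Admissible F 2 →
    B16.EndStatementBPrinted (Node00.datumOfRecord₁₃SepCoPH F 2 θ hP).C → Window13 F θ hP →
      ∃ (c C ρ : ℝ) (Λ : ℕ → ℕ → ℝ), 0 ≤ c ∧ 0 < ρ ∧ ρ < 1 ∧
        ScaleShiftRate c ρ θ.γ (Node00.datumOfRecord₁₃SepCoPH F 2 θ hP).βfun ∧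
          HistLipschitz Λ θ.γ (Node00.datumOfRecord₁₃SepCoPH F 2 θ hP).βfun ∧ T4CouplingMatching.FadingMemory C ρ Λ

/-- p609637 LINE 2⁰ texts -/
def CornerSign13K : Prop :=
  ∀ (F : T4Family) (θ : Node00.Stage13HParams F 2) (hP : θ.Provisos₁₃SepCoPH F 2), (θ.ZhUnity F 2 ∧ θ.SlotsNondegenerate₁₃ F 2) → θ.Admissible F 2 →
    B16.EndStatementBPrinted (Node00.datumOfRecord₁₃SepCoPH F 2 θ hP).C → Window13 F θ hP →
      ∀ b : ℕ → ℝ, ScaleAnchor (Node00.datumOfRecord₁₃SepCoPH F 2 θ hP).βfun b → ∃ e : ℝ, 0 < e ∧ ∃ k₀ : ℕ, ∀ k, k₀ ≤ k → e ≤ b k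
/-- p609637 -/
def SomeCornerPos13K : Prop :=
  ∀ (F : T4Family) (θ : Node00.Stage13HParams F 2) (hP : θ.Provisos₁₃SepCoPH F 2), (θ.ZhUnity F 2 ∧ θ.SlotsNondegenerate₁₃ F 2) → θ.Admissible F 2 →
    B16.EndStatementBPrinted (Node00.datumOfRecord₁₃SepCoPH F 2 θ hP).C → Window13 F θ hP →
      ∃ b : ℕ → ℝ, ScaleAnchor (Node00.datumOfRecord₁₃SepCoPH F 2 θ hP).βfun b ∧ ∃ e : ℝ, 0 < e ∧ ∃ k₀ : ℕ, ∀ k, k₀ ≤ k → e ≤ b k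

/-- scratch stubs -/
theorem stub_u3Triple13K : U3TripleAtRecord13K := by sorry
/-- scratch (v7c's registered name and text) -/
theorem stub_cornerDriftPos13 : CornerDriftPos := by sorry
/-- scratch -/
theorem stub_someCornerPos13K : SomeCornerPos13K := by sorry
/-- scratch -/
theorem stub_cornerSign13K : CornerSign13K := by sorry

/-- BY NAME: v7c's OWN 2ᶜᴰ stub + U3ᴷ close the crux decl by ONE tree name. -/
example : Summit.QuantumFields.YangMills.Theses.BalabanUVNodes.EndpointGivenBR13SepCoPH :=
  EndpointGivenBR13SepCoPH_of_u3K_cornerDriftPosK stub_u3Triple13K stub_cornerDriftPos13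
/-- BY NAME: on U3ᴷ, 2ᶜᴰ ⟺ the κ-free sign bit. -/
example : CornerDriftPos ↔ SomeCornerPos13K := cornerDriftPosK_iff_someCornerPosK_of_u3K stub_u3Triple13K
/-- BY NAME -/
example : CornerDriftPos := cornerDriftPosK_of_u3K_someCornerPosK stub_u3Triple13K stub_someCornerPos13K
/-- BY NAME -/
example : CornerDriftPos := cornerDriftPosK_of_u3K_cornerSignK stub_u3Triple13K stub_cornerSign13K
/-- BY NAME -/
example : SomeCornerPos13K := someCornerPosK_of_u3K_cornerDriftPosK stub_u3Triple13K stub_cornerDriftPos13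

end Summit.QuantumFields.YangMills.Cruxes.EndpointGivenBR13SepCoPH.Port2CornerDriftOfU3Apply

end
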